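import Literature.MathematicalPhysics.KineticTheory.KickMatchedSwapRestart
import HarnessLib

/-!
# Collision times of a noise-driven hard-sphere flow: the pathwise dictionary with its instants

Topic `Literature/MathematicalPhysics/KineticTheory`; companion of `KickMatchedHardSphereGas(Pieces)` and
`KickMatchedSwapRestart` (crux `stmt-AtomisticToContinuum-13914`, line `stein-lindeberg-kick-swap`, stub S1
`FairGasContactChaos`: the common prerequisite of its finite-collision piece, of the measurability of the `Z*` defect
and of the one-kick swap). For a `Driven` flow `Λ_t(z; ξ) = Driven.flow G ε R ξs z t` (free flight to the exit time,
then the noise-driven pair rule `R`, CIP 1994 App. 4.A with the reflection replaced by `R`) we prove, PATHWISE and for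
an arbitrary rule, the dictionary between the geometric contact times `collisionTimes G ε (Λ_·(z; ξ))` of the path and
the collision instants `t_k = Driven.instant … k`, under explicit regularity hypotheses on the orbit — exactly the
three clauses of `Alexander.FwdGood` for the deterministic dynamics (GST 2013 Prop. 4.1.1, "non-pathological"):

* (H1) `hacc`: the instants do not accumulate, `∀ t, ∃ k, t < t_k` (clause (iii)(a) of `KickMatchedStationary`);
* (H2) `hgraz`: no pair touches strictly inside a free flight (no grazing contact);
* (H3) `hsep`: every post-collisional state has a positive exit time (no two collisions at one instant);
* (H4) `hcont`: every collision that happens leaves a pair in contact (for the kick-matched rule `kmRule` this holds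
  for EVERY die, `KickMatchedHardSphereGas.exists_stateAfter_succ_mem_contactSet`: the re-placed partner sits at exact
  contact along the resampled normal).

Results (namespace `Driven`, mirroring `Alexander.FwdGood.*` / `Alexander.mem_collisionTimes_flow_iff_of_pos` of
`HardSphereFlowOrbits` for the deterministic flow): segments `count_eq_of_segment`, `flow_eq_of_segment`;
`exists_segment`, `le_count_iff` (under (H1) `count t` is the honest number of instants `≤ t`); contacts happen only at
instants (`exists_instant_eq_of_flow_mem_contactSet`, (H1)+(H2)); the flow at a finite instant is the post-collisional
state (`flow_toReal_instant`, (H3)); the dictionary `mem_collisionTimes_flow_iff_of_pos`; the contact times in `(0, τ]`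
(and in `[0, τ]` for a datum off contact) are the image of `Finset.range (count τ)` under `k ↦ t_{k+1}`, injectively
(`collisionTimes_flow_inter_Ioc`, `collisionTimes_flow_inter_Icc`, `injOn_toReal_instant_succ`), hence finite, and
EVERY collision finsum is a finite sum over collision indices (`finsum_mem_collisionTimes_flow_inter_Icc`).
Specialisation (namespace `KickMatchedHardSphereGas`): the geometry of one kick (`sepVec_kickAt`: the kicked pair has
separation `ε ω`; `markAt_of_eq_kickAt`: the mark read on a kicked configuration is `(ω, v, w)` — the resampled normal
and the PRE-collisional velocities, by `reflectVel_reflectVel`), `kmRule_mem_contactSet`, and the rewriting of the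
defect's collision sum `collSum` along `Z*` as `∑_{k < count τ}` of the summand at `(t_{k+1}, z_{k+1})`
(`collSum_kmFlow_eq_sum`), the form in which the mark piece of the defect is a martingale transform.

References: C. Cercignani, R. Illner, M. Pulvirenti, *The Mathematical Theory of Dilute Gases* (1994), App. 4.A
(collision recursion, special-flow representation) [CIP1994]; I. Gallagher, L. Saint-Raymond, B. Texier, *From Newton
to Boltzmann* (2013), §4.1, Prop. 4.1.1 (pathological trajectories: grazing, multiple, accumulating collisions)
[GST2013]. Everything here is elementary bookkeeping on these definitions, tagged `[folklore]`.
-/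

noncomputable section

open scoped BigOperators ENNReal Topology RealInnerProductSpace
open MeasureTheory Set Filter
open Literature.Analysis.FluidPDE

namespace Literature.MathematicalPhysics.KineticTheory

namespace Driven

variable {d : Type*} [Fintype d] {X : Type*} {N : ℕ} {Ξ : Type*}
variable {G : Geometry d X} {ε : ℝ} {R : Fin N → Fin N → Config N d X → Ξ → Config N d X}
variable {ξs : ℕ → Ξ} {z : Config N d X}

/-! ## Segments of the driven flow (no hypotheses) -/

/-- If `t_k ≤ u < t_{k+1}` then `k` collisions are counted in `[0, u]` (monotonicity of the instants only).
[folklore] -/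
theorem count_eq_of_segment {u : ℝ} {k : ℕ} (h1 : instant G ε R ξs z k ≤ ENNReal.ofReal u)
    (h2 : ENNReal.ofReal u < instant G ε R ξs z (k + 1)) : count G ε R ξs z u = k := by
  have hub : ∀ m ∈ {m : ℕ | instant G ε R ξs z m ≤ ENNReal.ofReal u}, m ≤ k := by
    intro m hm
    by_contra hmk
    exact (not_le.2 h2) ((monotone_instant ξs z (Nat.succ_le_of_lt (not_le.1 hmk))).trans hm)
  exact le_antisymm (csSup_le' hub) (le_csSup ⟨k, hub⟩ h1)

/-- On the segment `t_k ≤ u < t_{k+1}` the driven flow is `S_{u - t_k} z_k`. [folklore] -/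
theorem flow_eq_of_segment {u : ℝ} {k : ℕ} (h1 : instant G ε R ξs z k ≤ ENNReal.ofReal u)
    (h2 : ENNReal.ofReal u < instant G ε R ξs z (k + 1)) :
    flow G ε R ξs z u = freeFlight G (u - (instant G ε R ξs z k).toReal) (stateAfter G ε R ξs z k) := by
  rw [flow, count_eq_of_segment h1 h2]

/-- For a datum with positive exit time the driven flow starts at the datum: `Λ_0 z = z`. [folklore] -/
theorem flow_zero_of_freeExitTime_pos (h0 : 0 < Alexander.freeExitTime G ε z) : flow G ε R ξs z 0 = z := by
  rw [flow_eq_freeFlight_of_lt_instant_one (by rwa [instant_one, ENNReal.ofReal_zero]), freeFlight_zero]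

/-- The post-collisional state after a collision with a UNIQUE incoming pair `p` is the rule applied to `p`:
`z_{k+1} = R p.1 p.2 (S_{τ(z_k)} z_k) (ξ_k)`. [folklore] -/
theorem stateAfter_succ_of_incomingPairs_eq {k : ℕ}
    (hτ : Alexander.freeExitTime G ε (stateAfter G ε R ξs z k) ≠ ∞) {p : Fin N × Fin N}
    (hp : Alexander.incomingPairs G ε (freeFlight G (Alexander.freeExitTime G ε (stateAfter G ε R ξs z k)).toReal
      (stateAfter G ε R ξs z k)) = {p}) :
    stateAfter G ε R ξs z (k + 1) =
      R p.1 p.2 (freeFlight G (Alexander.freeExitTime G ε (stateAfter G ε R ξs z k)).toReal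
        (stateAfter G ε R ξs z k)) (ξs k) := by
  classical
  have hne : (Alexander.incomingPairs G ε (freeFlight G (Alexander.freeExitTime G ε
      (stateAfter G ε R ξs z k)).toReal (stateAfter G ε R ξs z k))).Nonempty := ⟨p, by rw [hp]; rfl⟩
  have hsome : hne.some = p := hp.subset hne.some_mem
  rw [stateAfter_succ, step, if_neg hτ]
  dsimp only
  rw [dif_pos hne, hsome]

/-! ## Non-accumulating instants: every time lies in a segment, and `count` is honest -/

section NoAccumulation

/-- (H1) ⟹ every time `u` lies in a segment `[t_k, t_{k+1})`. [folklore] -/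
theorem exists_segment (hacc : ∀ t : ℝ, ∃ k, ENNReal.ofReal t < instant G ε R ξs z k) (u : ℝ) :
    ∃ k, instant G ε R ξs z k ≤ ENNReal.ofReal u ∧ ENNReal.ofReal u < instant G ε R ξs z (k + 1) := by
  classical
  have hex : ∃ k, ENNReal.ofReal u < instant G ε R ξs z k := hacc u
  have hK := Nat.find_spec hex
  have hK0 : Nat.find hex ≠ 0 := by
    intro h0
    rw [h0, instant_zero] at hK
    exact ENNReal.not_lt_zero hK
  obtain ⟨k, hk⟩ := Nat.exists_eq_succ_of_ne_zero hK0
  rw [hk] at hK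
  exact ⟨k, not_lt.1 (Nat.find_min hex (by omega)), hK⟩

/-- (H1) ⟹ `k ≤ count u ↔ t_k ≤ u`: the number of collisions in `[0, u]` is the honest number of instants of
positive index in `[0, u]`. [folklore] -/
theorem le_count_iff (hacc : ∀ t : ℝ, ∃ k, ENNReal.ofReal t < instant G ε R ξs z k) {u : ℝ} {k : ℕ} :
    k ≤ count G ε R ξs z u ↔ instant G ε R ξs z k ≤ ENNReal.ofReal u := by
  obtain ⟨m, h1, h2⟩ := exists_segment hacc u
  rw [count_eq_of_segment h1 h2]
  constructor
  · exact fun hk => (monotone_instant ξs z hk).trans h1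
  · intro hk
    by_contra hlt
    exact (not_le.2 h2) ((monotone_instant ξs z (Nat.succ_le_of_lt (not_le.1 hlt))).trans hk)

/-- (H1) ⟹ `t_{count u} ≤ u`. [folklore] -/
theorem instant_count_le (hacc : ∀ t : ℝ, ∃ k, ENNReal.ofReal t < instant G ε R ξs z k) (u : ℝ) :
    instant G ε R ξs z (count G ε R ξs z u) ≤ ENNReal.ofReal u :=
  (le_count_iff hacc).1 le_rfl

/-- (H1) ⟹ `u < t_{count u + 1}`. [folklore] -/
theorem lt_instant_count_succ (hacc : ∀ t : ℝ, ∃ k, ENNReal.ofReal t < instant G ε R ξs z k) (u : ℝ) :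
    ENNReal.ofReal u < instant G ε R ξs z (count G ε R ξs z u + 1) := by
  by_contra h
  have h' := (le_count_iff hacc).2 (not_lt.1 h)
  omega

/-- (H1) ⟹ the instants of index `≤ count u` are finite. [folklore] -/
theorem instant_ne_top_of_le_count (hacc : ∀ t : ℝ, ∃ k, ENNReal.ofReal t < instant G ε R ξs z k) {u : ℝ}
    {k : ℕ} (hk : k ≤ count G ε R ξs z u) : instant G ε R ξs z k ≠ ∞ :=
  ne_top_of_le_ne_top ENNReal.ofReal_ne_top ((le_count_iff hacc).1 hk)

/-- (H1) ⟹ the driven flow stays in the hard-sphere domain at nonnegative times (each segment is a free flight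
strictly shorter than its exit time). [folklore] -/
theorem flow_mem_hardSphereDomain (hacc : ∀ t : ℝ, ∃ k, ENNReal.ofReal t < instant G ε R ξs z k) {u : ℝ}
    (hu : 0 ≤ u) : flow G ε R ξs z u ∈ hardSphereDomain G N ε := by
  obtain ⟨k, h1, h2⟩ := exists_segment hacc u
  rw [flow_eq_of_segment h1 h2]
  refine Alexander.freeFlight_mem_hardSphereDomain_of_lt (sub_nonneg.2 (ENNReal.toReal_le_of_le_ofReal hu h1)) ?_
  rw [instant_succ] at h2
  exact Alexander.ofReal_sub_toReal_lt hu h1 h2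

/-- **Contacts happen only at instants** ((H1) + (H2), right-continuous flow): a contact at a positive time `u`
forces `u = t_k` for some `k ≥ 1`. [folklore] -/
theorem exists_instant_eq_of_flow_mem_contactSet
    (hacc : ∀ t : ℝ, ∃ k, ENNReal.ofReal t < instant G ε R ξs z k)
    (hgraz : ∀ (k : ℕ) (t : ℝ), 0 < t → ENNReal.ofReal t < Alexander.freeExitTime G ε (stateAfter G ε R ξs z k) →
      ∀ i j : Fin N, i ≠ j → freeFlight G t (stateAfter G ε R ξs z k) ∉ contactSet G N ε i j)
    {u : ℝ} (hu : 0 < u) {i j : Fin N} (hij : i ≠ j) (hc : flow G ε R ξs z u ∈ contactSet G N ε i j) :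
    ∃ k, 0 < k ∧ instant G ε R ξs z k = ENNReal.ofReal u := by
  obtain ⟨k, h1, h2⟩ := exists_segment hacc u
  rcases h1.lt_or_eq with hlt | heq
  · exfalso
    rw [flow_eq_of_segment h1 h2] at hc
    refine hgraz k _ (sub_pos.2 (ENNReal.toReal_lt_of_lt_ofReal hlt)) ?_ i j hij hc
    rw [instant_succ] at h2
    exact Alexander.ofReal_sub_toReal_lt hu.le h1 h2
  · refine ⟨k, Nat.pos_of_ne_zero ?_, heq⟩
    rintro rfl
    rw [instant_zero] at heq
    exact (ENNReal.ofReal_pos.2 hu).ne heq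

end NoAccumulation

/-! ## Separated instants: the flow at an instant is the post-collisional state -/

section Separated

/-- (H3) ⟹ the finite instants of positive index are strictly increasing: `t_k < t_{k+1}`. [folklore] -/
theorem instant_lt_succ (hsep : ∀ k, 0 < Alexander.freeExitTime G ε (stateAfter G ε R ξs z (k + 1))) {k : ℕ}
    (hk : 0 < k) (hfin : instant G ε R ξs z k ≠ ∞) : instant G ε R ξs z k < instant G ε R ξs z (k + 1) := by
  rw [instant_succ]
  obtain ⟨m, rfl⟩ := Nat.exists_eq_succ_of_ne_zero hk.ne'
  exact ENNReal.lt_add_right hfin (hsep m).ne'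

/-- `t_k < t_{k+1}` as soon as `t_k` is finite and either `k > 0` ((H3)) or `τ(z) > 0`. [folklore] -/
theorem instant_lt_succ' (hsep : ∀ k, 0 < Alexander.freeExitTime G ε (stateAfter G ε R ξs z (k + 1))) {k : ℕ}
    (hk : 0 < k ∨ 0 < Alexander.freeExitTime G ε z) (hfin : instant G ε R ξs z k ≠ ∞) :
    instant G ε R ξs z k < instant G ε R ξs z (k + 1) := by
  rcases Nat.eq_zero_or_pos k with rfl | hpos
  · have h0 : 0 < Alexander.freeExitTime G ε z := hk.resolve_left (lt_irrefl 0)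
    rwa [instant_zero, zero_add, instant_one]
  · exact instant_lt_succ hsep hpos hfin

/-- (H3) ⟹ strict monotonicity: `t_k < t_m` for `k < m`, `t_k` finite, `k > 0` or `τ(z) > 0`. [folklore] -/
theorem instant_lt_instant (hsep : ∀ k, 0 < Alexander.freeExitTime G ε (stateAfter G ε R ξs z (k + 1)))
    {k m : ℕ} (hkm : k < m) (hk : 0 < k ∨ 0 < Alexander.freeExitTime G ε z) (hfin : instant G ε R ξs z k ≠ ∞) :
    instant G ε R ξs z k < instant G ε R ξs z m :=
  (instant_lt_succ' hsep hk hfin).trans_le (monotone_instant ξs z (Nat.succ_le_of_lt hkm))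

/-- **The flow at a finite instant is the post-collisional state** (right-continuity convention):
`Λ_{t_k} = z_k`, for `k > 0` ((H3)) or `τ(z) > 0`. [folklore] -/
theorem flow_toReal_instant (hsep : ∀ k, 0 < Alexander.freeExitTime G ε (stateAfter G ε R ξs z (k + 1)))
    {k : ℕ} (hfin : instant G ε R ξs z k ≠ ∞) (hk : 0 < k ∨ 0 < Alexander.freeExitTime G ε z) :
    flow G ε R ξs z (instant G ε R ξs z k).toReal = stateAfter G ε R ξs z k := by
  rw [flow_eq_of_segment (k := k) (by rw [ENNReal.ofReal_toReal hfin])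
    (by rw [ENNReal.ofReal_toReal hfin]; exact instant_lt_succ' hsep hk hfin), sub_self, freeFlight_zero]

/-- (H3) + (H4) ⟹ **every finite instant of positive index is a collision time** of the path. [folklore] -/
theorem toReal_instant_succ_mem_collisionTimes
    (hsep : ∀ k, 0 < Alexander.freeExitTime G ε (stateAfter G ε R ξs z (k + 1)))
    (hcont : ∀ k, Alexander.freeExitTime G ε (stateAfter G ε R ξs z k) ≠ ∞ →
      ∃ i j : Fin N, i ≠ j ∧ stateAfter G ε R ξs z (k + 1) ∈ contactSet G N ε i j)
    {k : ℕ} (hfin : instant G ε R ξs z (k + 1) ≠ ∞) :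
    (instant G ε R ξs z (k + 1)).toReal ∈ collisionTimes G ε (flow G ε R ξs z) := by
  have hτ : Alexander.freeExitTime G ε (stateAfter G ε R ξs z k) ≠ ∞ := by
    rw [instant_succ, ENNReal.add_ne_top] at hfin
    exact hfin.2
  obtain ⟨i, j, hij, hc⟩ := hcont k hτ
  refine ⟨i, j, hij, ?_⟩
  rw [flow_toReal_instant hsep hfin (Or.inl k.succ_pos)]
  exact hc

/-- `k ↦ t_{k+1}` (as real numbers) is injective on the collision indices `k < count τ` ((H1) + (H3)). [folklore] -/
theorem injOn_toReal_instant_succ (hacc : ∀ t : ℝ, ∃ k, ENNReal.ofReal t < instant G ε R ξs z k)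
    (hsep : ∀ k, 0 < Alexander.freeExitTime G ε (stateAfter G ε R ξs z (k + 1))) (τ : ℝ) :
    Set.InjOn (fun k => (instant G ε R ξs z (k + 1)).toReal) ↑(Finset.range (count G ε R ξs z τ)) := by
  have hfin : ∀ k ∈ (↑(Finset.range (count G ε R ξs z τ)) : Set ℕ), instant G ε R ξs z (k + 1) ≠ ∞ := by
    intro k hk
    rw [Finset.coe_range, mem_Iio] at hk
    exact instant_ne_top_of_le_count hacc (Nat.succ_le_of_lt hk)
  intro k hk m hm hkm
  have h := (ENNReal.toReal_eq_toReal_iff' (hfin k hk) (hfin m hm)).1 hkm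
  by_contra hne
  rcases lt_or_gt_of_ne hne with hlt | hlt
  · exact (instant_lt_instant hsep (Nat.succ_lt_succ hlt) (Or.inl k.succ_pos) (hfin k hk)).ne h
  · exact (instant_lt_instant hsep (Nat.succ_lt_succ hlt) (Or.inl m.succ_pos) (hfin m hm)).ne h.symm

end Separated

/-! ## The dictionary -/

section Dictionary

/-- **The positive collision times of a driven path are its instants** ((H1)–(H4)): for `t > 0`,
`t ∈ collisionTimes ↔ t = t_k` for some `k ≥ 1`. [folklore] -/
theorem mem_collisionTimes_flow_iff_of_pos (hacc : ∀ t : ℝ, ∃ k, ENNReal.ofReal t < instant G ε R ξs z k)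
    (hgraz : ∀ (k : ℕ) (t : ℝ), 0 < t → ENNReal.ofReal t < Alexander.freeExitTime G ε (stateAfter G ε R ξs z k) →
      ∀ i j : Fin N, i ≠ j → freeFlight G t (stateAfter G ε R ξs z k) ∉ contactSet G N ε i j)
    (hsep : ∀ k, 0 < Alexander.freeExitTime G ε (stateAfter G ε R ξs z (k + 1)))
    (hcont : ∀ k, Alexander.freeExitTime G ε (stateAfter G ε R ξs z k) ≠ ∞ →
      ∃ i j : Fin N, i ≠ j ∧ stateAfter G ε R ξs z (k + 1) ∈ contactSet G N ε i j)
    {t : ℝ} (ht : 0 < t) :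
    t ∈ collisionTimes G ε (flow G ε R ξs z) ↔ ∃ k, 0 < k ∧ instant G ε R ξs z k = ENNReal.ofReal t := by
  constructor
  · rintro ⟨i, j, hij, hc⟩
    exact exists_instant_eq_of_flow_mem_contactSet hacc hgraz ht hij hc
  · rintro ⟨k, hk, hkt⟩
    obtain ⟨m, rfl⟩ := Nat.exists_eq_succ_of_ne_zero hk.ne'
    have hfin : instant G ε R ξs z (m + 1) ≠ ∞ := by rw [hkt]; exact ENNReal.ofReal_ne_top
    have ht' : t = (instant G ε R ξs z (m + 1)).toReal := by rw [hkt, ENNReal.toReal_ofReal ht.le]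
    rw [ht']
    exact toReal_instant_succ_mem_collisionTimes hsep hcont hfin

/-- **The collision times in `(0, τ]` are the instants `t_1 < … < t_{count τ}`** ((H1)–(H4), `τ(z) > 0`): the image of
`Finset.range (count τ)` under `k ↦ t_{k+1}`. [folklore] -/
theorem collisionTimes_flow_inter_Ioc (hacc : ∀ t : ℝ, ∃ k, ENNReal.ofReal t < instant G ε R ξs z k)
    (hgraz : ∀ (k : ℕ) (t : ℝ), 0 < t → ENNReal.ofReal t < Alexander.freeExitTime G ε (stateAfter G ε R ξs z k) →
      ∀ i j : Fin N, i ≠ j → freeFlight G t (stateAfter G ε R ξs z k) ∉ contactSet G N ε i j)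
    (hsep : ∀ k, 0 < Alexander.freeExitTime G ε (stateAfter G ε R ξs z (k + 1)))
    (hcont : ∀ k, Alexander.freeExitTime G ε (stateAfter G ε R ξs z k) ≠ ∞ →
      ∃ i j : Fin N, i ≠ j ∧ stateAfter G ε R ξs z (k + 1) ∈ contactSet G N ε i j)
    (h0 : 0 < Alexander.freeExitTime G ε z) (τ : ℝ) :
    collisionTimes G ε (flow G ε R ξs z) ∩ Ioc 0 τ =
      (fun k => (instant G ε R ξs z (k + 1)).toReal) '' ↑(Finset.range (count G ε R ξs z τ)) := by
  ext t
  simp only [mem_inter_iff, mem_Ioc, mem_image, Finset.coe_range, mem_Iio]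
  constructor
  · rintro ⟨ht, ht0, htτ⟩
    obtain ⟨k, hk, hkt⟩ := (mem_collisionTimes_flow_iff_of_pos hacc hgraz hsep hcont ht0).1 ht
    obtain ⟨m, rfl⟩ := Nat.exists_eq_succ_of_ne_zero hk.ne'
    refine ⟨m, ?_, by rw [hkt, ENNReal.toReal_ofReal ht0.le]⟩
    have h : m + 1 ≤ count G ε R ξs z τ := (le_count_iff hacc).2 (hkt ▸ ENNReal.ofReal_le_ofReal htτ)
    omega
  · rintro ⟨m, hm, rfl⟩
    have hle : instant G ε R ξs z (m + 1) ≤ ENNReal.ofReal τ := (le_count_iff hacc).1 (Nat.succ_le_of_lt hm)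
    have hfin : instant G ε R ξs z (m + 1) ≠ ∞ := ne_top_of_le_ne_top ENNReal.ofReal_ne_top hle
    have hpos : 0 < instant G ε R ξs z (m + 1) := by
      refine h0.trans_le ?_
      rw [← instant_one ξs z]
      exact monotone_instant ξs z (Nat.le_add_left 1 m)
    have hτ : 0 ≤ τ := by
      by_contra hτ
      rw [ENNReal.ofReal_of_nonpos (not_le.1 hτ).le, nonpos_iff_eq_zero] at hle
      exact hpos.ne' hle
    exact ⟨toReal_instant_succ_mem_collisionTimes hsep hcont hfin, ENNReal.toReal_pos hpos.ne' hfin,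
      ENNReal.toReal_le_of_le_ofReal hτ hle⟩

/-- **The collision times in `[0, τ]`** of a driven path from a datum OFF CONTACT are the same image (time `0` is
not a collision time: `Λ_0 z = z`). [folklore] -/
theorem collisionTimes_flow_inter_Icc (hacc : ∀ t : ℝ, ∃ k, ENNReal.ofReal t < instant G ε R ξs z k)
    (hgraz : ∀ (k : ℕ) (t : ℝ), 0 < t → ENNReal.ofReal t < Alexander.freeExitTime G ε (stateAfter G ε R ξs z k) →
      ∀ i j : Fin N, i ≠ j → freeFlight G t (stateAfter G ε R ξs z k) ∉ contactSet G N ε i j)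
    (hsep : ∀ k, 0 < Alexander.freeExitTime G ε (stateAfter G ε R ξs z (k + 1)))
    (hcont : ∀ k, Alexander.freeExitTime G ε (stateAfter G ε R ξs z k) ≠ ∞ →
      ∃ i j : Fin N, i ≠ j ∧ stateAfter G ε R ξs z (k + 1) ∈ contactSet G N ε i j)
    (h0 : 0 < Alexander.freeExitTime G ε z) (hz0 : ∀ i j : Fin N, i ≠ j → z ∉ contactSet G N ε i j) (τ : ℝ) :
    collisionTimes G ε (flow G ε R ξs z) ∩ Icc 0 τ =
      (fun k => (instant G ε R ξs z (k + 1)).toReal) '' ↑(Finset.range (count G ε R ξs z τ)) := by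
  rw [← collisionTimes_flow_inter_Ioc hacc hgraz hsep hcont h0 τ]
  ext t
  simp only [mem_inter_iff, mem_Icc, mem_Ioc]
  constructor
  · rintro ⟨ht, ht0, htτ⟩
    refine ⟨ht, lt_of_le_of_ne ht0 ?_, htτ⟩
    rintro rfl
    obtain ⟨i, j, hij, hc⟩ := ht
    rw [flow_zero_of_freeExitTime_pos h0] at hc
    exact hz0 i j hij hc
  · rintro ⟨ht, ht0, htτ⟩
    exact ⟨ht, ht0.le, htτ⟩

/-- **Finitely many collision times in `[0, τ]`** for a regular driven path. [folklore] -/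
theorem finite_collisionTimes_flow_inter_Icc (hacc : ∀ t : ℝ, ∃ k, ENNReal.ofReal t < instant G ε R ξs z k)
    (hgraz : ∀ (k : ℕ) (t : ℝ), 0 < t → ENNReal.ofReal t < Alexander.freeExitTime G ε (stateAfter G ε R ξs z k) →
      ∀ i j : Fin N, i ≠ j → freeFlight G t (stateAfter G ε R ξs z k) ∉ contactSet G N ε i j)
    (hsep : ∀ k, 0 < Alexander.freeExitTime G ε (stateAfter G ε R ξs z (k + 1)))
    (hcont : ∀ k, Alexander.freeExitTime G ε (stateAfter G ε R ξs z k) ≠ ∞ →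
      ∃ i j : Fin N, i ≠ j ∧ stateAfter G ε R ξs z (k + 1) ∈ contactSet G N ε i j)
    (h0 : 0 < Alexander.freeExitTime G ε z) (hz0 : ∀ i j : Fin N, i ≠ j → z ∉ contactSet G N ε i j) (τ : ℝ) :
    (collisionTimes G ε (flow G ε R ξs z) ∩ Icc 0 τ).Finite := by
  rw [collisionTimes_flow_inter_Icc hacc hgraz hsep hcont h0 hz0 τ]
  exact (Finset.finite_toSet _).image _

/-- **Every collision finsum of a regular driven path is a finite sum over collision indices**:
`∑ᶠ_{t ∈ collisionTimes ∩ [0, τ]} f t = ∑_{k < count τ} f (t_{k+1})`. [folklore] -/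
theorem finsum_mem_collisionTimes_flow_inter_Icc {M : Type*} [AddCommMonoid M]
    (hacc : ∀ t : ℝ, ∃ k, ENNReal.ofReal t < instant G ε R ξs z k)
    (hgraz : ∀ (k : ℕ) (t : ℝ), 0 < t → ENNReal.ofReal t < Alexander.freeExitTime G ε (stateAfter G ε R ξs z k) →
      ∀ i j : Fin N, i ≠ j → freeFlight G t (stateAfter G ε R ξs z k) ∉ contactSet G N ε i j)
    (hsep : ∀ k, 0 < Alexander.freeExitTime G ε (stateAfter G ε R ξs z (k + 1)))
    (hcont : ∀ k, Alexander.freeExitTime G ε (stateAfter G ε R ξs z k) ≠ ∞ →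
      ∃ i j : Fin N, i ≠ j ∧ stateAfter G ε R ξs z (k + 1) ∈ contactSet G N ε i j)
    (h0 : 0 < Alexander.freeExitTime G ε z) (hz0 : ∀ i j : Fin N, i ≠ j → z ∉ contactSet G N ε i j) (τ : ℝ)
    (f : ℝ → M) :
    ∑ᶠ t ∈ collisionTimes G ε (flow G ε R ξs z) ∩ Icc 0 τ, f t =
      ∑ k ∈ Finset.range (count G ε R ξs z τ), f (instant G ε R ξs z (k + 1)).toReal := by
  rw [collisionTimes_flow_inter_Icc hacc hgraz hsep hcont h0 hz0 τ, finsum_mem_image (injOn_toReal_instant_succ hacc hsep τ),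
    finsum_mem_coe_finset]

end Dictionary

end Driven

end Literature.MathematicalPhysics.KineticTheory

end
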